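import Literature.Topology.FourManifolds.MorseLemma
import Literature.Topology.FourManifolds.GradientLikeDynamics

/-!
# Disjoint Euclidean Morse charts at finitely many critical points of one level, and their
# transport by a diffeomorphism

Topic `Literature/Topology/FourManifolds` (Morse theory; fact seat
`provefact-Literature.Geometry.Riemannian.LawsonMichelsohn1984_surrounding`, whose sweep over the
critical levels of a Morse function on `ℝ^{m+1}` feeds the chart data of
`exists_thinHandleFunction` (`ThinHandleFunction.lean`), Milnor, *Morse theory* (1963), proof
of Thm. 3.2).  Everything here is **proved**; no definitions, no named facts.

* `exists_pos_forall_le_finset` — a finite family of positive reals has a positive lower bound.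
* `exists_morseCharts_finset` — **disjoint Morse charts at a finite set of nondegenerate
  critical points of one level `c`** of a smooth `f` on `ℝⁿ`: charts `e_p` of the `C^∞`
  maximal atlas of `ℝⁿ` with `e_p p = 0`, a common closed ball `B̄(0, R)` in the targets,
  Milnor's normal form `f ∘ e_p⁻¹ = c - ξ + η` **on the whole target** (`ξ = sqSumLT λ_p`,
  `η = sqSumGE λ_p`, `λ_p` the negative index of inertia of `D²f(p)`), and pairwise disjoint
  closed chart balls `e_p⁻¹ B̄(0, R)` inside a prescribed open set — the Morse lemma of the tree
  (`exists_openPartialHomeomorph_comp_symm_eq_sum_sq`, Hirsch 1976, Ch. 6 §1, Thm. 1.1;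
  Milnor 1963, Lemma 2.2) translated to `p`, with the radius shrunk by continuity of `e_p⁻¹`
  at `0`.
* `exists_morseCharts_transport` — **transport by a diffeomorphism** `Φ` of `ℝⁿ`: the charts
  `e_p ∘ Φ⁻¹` at the points `Φ p` are Morse charts for `f ∘ Φ⁻¹` with the same targets, normal
  forms and radius, and disjoint closed chart balls `Φ(e_p⁻¹ B̄(0, R))`.

## References

* J. Milnor, *Morse theory*, Ann. of Math. Studies 51 (1963), Lemma 2.2, Thm. 3.2.
  [Milnor1963]
* M. W. Hirsch, *Differential Topology*, GTM 33 (1976), Ch. 6 §1, Thm. 1.1. [HirschDT1976]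
-/

noncomputable section

open scoped Manifold ContDiff Topology
open Set Function Filter Metric

namespace Literature.Topology.FourManifolds

variable {n : ℕ}

/-- A finite family of positive reals has a positive lower bound. [folklore] -/
theorem exists_pos_forall_le_finset {α : Type*} (P : Finset α) {r : α → ℝ}
    (hr : ∀ p ∈ P, 0 < r p) : ∃ R, 0 < R ∧ ∀ p ∈ P, R ≤ r p := by
  classical
  induction P using Finset.induction_on with
  | empty => exact ⟨1, one_pos, fun p hp => by simp at hp⟩
  | insert a s ha ih =>
    obtain ⟨R, hR, hRs⟩ := ih fun p hp => hr p (Finset.mem_insert_of_mem hp)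
    refine ⟨min (r a) R, lt_min (hr a (Finset.mem_insert_self a s)) hR, fun p hp => ?_⟩
    rcases Finset.mem_insert.1 hp with rfl | hp
    · exact min_le_left _ _
    · exact (min_le_right _ _).trans (hRs p hp)

/-- An open partial homeomorphism of `ℝⁿ` which is `C^∞` on its source with inverse `C^∞` on its
target is a chart of the `C^∞` maximal atlas of `ℝⁿ`. [folklore] -/
theorem mem_maximalAtlas_of_contDiffOn (e : OpenPartialHomeomorph (EuclideanSpace ℝ (Fin n)) (EuclideanSpace ℝ (Fin n)))
    (he : ContDiffOn ℝ ∞ e e.source) (he' : ContDiffOn ℝ ∞ e.symm e.target) :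
    e ∈ IsManifold.maximalAtlas (𝓡 n) ∞ (EuclideanSpace ℝ (Fin n)) := by
  rw [IsManifold.mem_maximalAtlas_iff_contMDiffOn]
  exact ⟨contMDiffOn_iff_contDiffOn.2 he, contMDiffOn_iff_contDiffOn.2 he'⟩

/-- **Disjoint Morse charts at a finite set of nondegenerate critical points of one level.**
Let `f` be `C^∞` on `ℝⁿ`, `P` a finite set of points with `f = c`, `df = 0` and nondegenerate
`D²f` on `P`, and `W` an open set containing `P`.  Then there are `R > 0` and charts `e_p`
(`p ∈ P`) of the `C^∞` maximal atlas of `ℝⁿ` with `p ∈ e_p.source`, `e_p p = 0`,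
`B̄(0, R) ⊆ e_p.target`, `f (e_p⁻¹ y) = c - ξ(y) + η(y)` for all `y ∈ e_p.target` (splitting
at the index `λ_p = sigNeg D²f(p)`), pairwise disjoint closed chart balls `e_p⁻¹ B̄(0, R)`, all
contained in `W`. [cite: Milnor1963, Lemma 2.2; HirschDT1976, Ch. 6 §1, Thm. 1.1] -/
theorem exists_morseCharts_finset {f : EuclideanSpace ℝ (Fin n) → ℝ} (hf : ContDiff ℝ ∞ f) (P : Finset (EuclideanSpace ℝ (Fin n))) {c : ℝ}
    (hPc : ∀ p ∈ P, f p = c) (hcrit : ∀ p ∈ P, fderiv ℝ f p = 0)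
    (hnd : ∀ p ∈ P, ∀ u, (∀ v, fderiv ℝ (fderiv ℝ f) p u v = 0) → u = 0)
    {W : Set (EuclideanSpace ℝ (Fin n))} (hW : IsOpen W) (hPW : ∀ p ∈ P, p ∈ W) :
    ∃ (R : ℝ) (e : EuclideanSpace ℝ (Fin n) → OpenPartialHomeomorph (EuclideanSpace ℝ (Fin n)) (EuclideanSpace ℝ (Fin n))), 0 < R ∧
      (∀ p ∈ P, e p ∈ IsManifold.maximalAtlas (𝓡 n) ∞ (EuclideanSpace ℝ (Fin n))) ∧
      (∀ p ∈ P, p ∈ (e p).source ∧ e p p = 0) ∧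
      (∀ p ∈ P, closedBall (0 : EuclideanSpace ℝ (Fin n)) R ⊆ (e p).target) ∧
      (∀ p ∈ P, ∀ y ∈ (e p).target, f ((e p).symm y) =
        c - sqSumLT (sigNeg ((fderiv ℝ (fderiv ℝ f) p).toBilinForm).toQuadraticMap) y
          + sqSumGE (sigNeg ((fderiv ℝ (fderiv ℝ f) p).toBilinForm).toQuadraticMap) y) ∧
      (∀ p ∈ P, ∀ p' ∈ P, p ≠ p' →
        Disjoint ((e p).symm '' closedBall (0 : EuclideanSpace ℝ (Fin n)) R) ((e p').symm '' closedBall (0 : EuclideanSpace ℝ (Fin n)) R)) ∧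
      (∀ p ∈ P, (e p).symm '' closedBall (0 : EuclideanSpace ℝ (Fin n)) R ⊆ W) := by
  classical
  -- Step 1: the Morse lemma at each point, translated
  have hK : ∀ p, ∃ K : OpenPartialHomeomorph (EuclideanSpace ℝ (Fin n)) (EuclideanSpace ℝ (Fin n)), p ∈ P →
      (0 : EuclideanSpace ℝ (Fin n)) ∈ K.source ∧ K 0 = 0 ∧ ContDiffOn ℝ ∞ K K.source ∧
      ContDiffOn ℝ ∞ K.symm K.target ∧
      ∀ y ∈ K.target, f (p + K.symm y) =
        c - sqSumLT (sigNeg ((fderiv ℝ (fderiv ℝ f) p).toBilinForm).toQuadraticMap) y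
          + sqSumGE (sigNeg ((fderiv ℝ (fderiv ℝ f) p).toBilinForm).toQuadraticMap) y := by
    intro p
    by_cases hp : p ∈ P
    swap
    · exact ⟨OpenPartialHomeomorph.refl _, fun h => absurd h hp⟩
    set h : EuclideanSpace ℝ (Fin n) → ℝ := fun v => f (p + v) - c with hh
    have hhc : ContDiff ℝ ∞ h := (hf.comp (contDiff_const.add contDiff_id)).sub contDiff_const
    have h0 : h 0 = 0 := by simp [hh, hPc p hp]
    have hD1 : fderiv ℝ h = fun v => fderiv ℝ f (p + v) := by
      funext v
      rw [hh]
      rw [fderiv_sub_const, fderiv_comp_add_left]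
    have h0' : fderiv ℝ h 0 = 0 := by rw [hD1]; simpa using hcrit p hp
    have hD2 : fderiv ℝ (fderiv ℝ h) 0 = fderiv ℝ (fderiv ℝ f) p := by
      rw [hD1, fderiv_comp_add_left]; simp
    have hH : ∀ u, (∀ v, fderiv ℝ (fderiv ℝ h) 0 u v = 0) → u = 0 := by
      rw [hD2]; exact hnd p hp
    obtain ⟨K, hK0, hK00, -, hKs, hKs', hquad⟩ :=
      exists_openPartialHomeomorph_comp_symm_eq_sum_sq hhc h0 h0' hH univ_mem
    refine ⟨K, fun _ => ⟨hK0, hK00, hKs, hKs', fun y hy => ?_⟩⟩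
    have := hquad y hy
    rw [hD2] at this
    change f (p + K.symm y) - c = _ at this
    rw [sqSumLT, sqSumGE]
    linarith
  choose K hK using hK
  have hK0 : ∀ p ∈ P, (0 : EuclideanSpace ℝ (Fin n)) ∈ (K p).source := fun p hp => (hK p hp).1
  have hK00 : ∀ p ∈ P, K p 0 = 0 := fun p hp => (hK p hp).2.1
  have hKs : ∀ p ∈ P, ContDiffOn ℝ ∞ (K p) (K p).source := fun p hp => (hK p hp).2.2.1
  have hKs' : ∀ p ∈ P, ContDiffOn ℝ ∞ (K p).symm (K p).target := fun p hp => (hK p hp).2.2.2.1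
  have hKquad : ∀ p ∈ P, ∀ y ∈ (K p).target, f (p + (K p).symm y) =
      c - sqSumLT (sigNeg ((fderiv ℝ (fderiv ℝ f) p).toBilinForm).toQuadraticMap) y
        + sqSumGE (sigNeg ((fderiv ℝ (fderiv ℝ f) p).toBilinForm).toQuadraticMap) y :=
    fun p hp => (hK p hp).2.2.2.2
  -- the translated charts
  set T : EuclideanSpace ℝ (Fin n) → OpenPartialHomeomorph (EuclideanSpace ℝ (Fin n)) (EuclideanSpace ℝ (Fin n)) := fun p =>
    (Homeomorph.addLeft p).symm.toOpenPartialHomeomorph with hT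
  have hTapp : ∀ p x, T p x = -p + x := fun p x => rfl
  have hTsymm : ∀ p y, (T p).symm y = p + y := fun p y => rfl
  set e : EuclideanSpace ℝ (Fin n) → OpenPartialHomeomorph (EuclideanSpace ℝ (Fin n)) (EuclideanSpace ℝ (Fin n)) := fun p => (T p).trans (K p) with he
  have heapp : ∀ p x, e p x = K p (-p + x) := fun p x => rfl
  have hesymm : ∀ p y, (e p).symm y = p + (K p).symm y := fun p y => rfl
  have hesource : ∀ p x, x ∈ (e p).source ↔ -p + x ∈ (K p).source := fun p x => by
    simp [he, hT]; rfl
  have hetarget : ∀ p, (e p).target = (K p).target := fun p => by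
    simp [he, hT]
  -- membership in the maximal atlas
  have hemax : ∀ p ∈ P, e p ∈ IsManifold.maximalAtlas (𝓡 n) ∞ (EuclideanSpace ℝ (Fin n)) := by
    intro p hp
    refine mem_maximalAtlas_of_contDiffOn (e p) ?_ ?_
    · have h1 : ContDiff ℝ ∞ fun x : EuclideanSpace ℝ (Fin n) => -p + x := contDiff_const.add contDiff_id
      have : (e p : EuclideanSpace ℝ (Fin n) → EuclideanSpace ℝ (Fin n)) = K p ∘ fun x => -p + x := funext fun x => heapp p x
      rw [this]
      exact (hKs p hp).comp h1.contDiffOn fun x hx => (hesource p x).1 hx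
    · have h1 : ContDiff ℝ ∞ fun y : EuclideanSpace ℝ (Fin n) => p + y := contDiff_const.add contDiff_id
      have : ((e p).symm : EuclideanSpace ℝ (Fin n) → EuclideanSpace ℝ (Fin n)) = (fun y => p + y) ∘ (K p).symm := funext fun y => hesymm p y
      rw [this, hetarget p]
      exact h1.comp_contDiffOn (hKs' p hp)
  -- Step 2: radii.  Disjoint small balls about the points of `P` inside `W`.
  have hρ : ∃ ρ, 0 < ρ ∧ (∀ p ∈ P, ball p ρ ⊆ W) ∧
      ∀ p ∈ P, ∀ p' ∈ P, p ≠ p' → Disjoint (ball p ρ) (ball p' ρ) := by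
    have h1 : ∀ p ∈ P, ∃ r, 0 < r ∧ ball p r ⊆ W := fun p hp =>
      Metric.isOpen_iff.1 hW p (hPW p hp)
    choose! r hr hrW using h1
    obtain ⟨RW, hRW, hRWle⟩ := exists_pos_forall_le_finset P hr
    set Q : Finset (EuclideanSpace ℝ (Fin n) × EuclideanSpace ℝ (Fin n)) := (P ×ˢ P).filter fun q => q.1 ≠ q.2 with hQ
    obtain ⟨δ₀, hδ₀, hδ₀le⟩ := exists_pos_forall_le_finset Q (r := fun q => dist q.1 q.2)
      fun q hq => by
        obtain ⟨-, hne⟩ := Finset.mem_filter.1 hq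
        exact dist_pos.2 hne
    refine ⟨min (δ₀ / 2) RW, lt_min (by positivity) hRW, fun p hp => ?_, fun p hp p' hp' hne => ?_⟩
    · exact (ball_subset_ball (min_le_right _ _)).trans ((ball_subset_ball (hRWle p hp)).trans (hrW p hp))
    · refine Set.disjoint_left.2 fun z hz hz' => ?_
      have hq : (p, p') ∈ Q := Finset.mem_filter.2 ⟨Finset.mem_product.2 ⟨hp, hp'⟩, hne⟩
      have h1 := hδ₀le _ hq
      have h2 : dist p p' < δ₀ := by
        calc dist p p' ≤ dist z p + dist z p' := dist_triangle_left _ _ _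
          _ < min (δ₀ / 2) RW + min (δ₀ / 2) RW := add_lt_add hz hz'
          _ ≤ δ₀ / 2 + δ₀ / 2 := add_le_add (min_le_left _ _) (min_le_left _ _)
          _ = δ₀ := by ring
      exact absurd h1 (not_le.2 h2)
  obtain ⟨ρ, hρpos, hρW, hρdisj⟩ := hρ
  -- Step 3: a common radius `R` with `B̄(0, R) ⊆ e_p.target` and `e_p⁻¹ B̄(0, R) ⊆ B(p, ρ)`
  have hR : ∀ p ∈ P, ∃ s, 0 < s ∧ closedBall (0 : EuclideanSpace ℝ (Fin n)) s ⊆ (e p).target ∧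
      ∀ y ∈ closedBall (0 : EuclideanSpace ℝ (Fin n)) s, (e p).symm y ∈ ball p ρ := by
    intro p hp
    have h0t : (0 : EuclideanSpace ℝ (Fin n)) ∈ (e p).target := by
      rw [hetarget p, ← hK00 p hp]; exact (K p).map_source (hK0 p hp)
    have hsymm0 : (e p).symm 0 = p := by
      rw [hesymm, ← hK00 p hp, (K p).left_inv (hK0 p hp), add_zero]
    have hc : ContinuousAt (e p).symm 0 := (e p).continuousAt_symm h0t
    have h1 : (e p).symm ⁻¹' ball p ρ ∈ 𝓝 (0 : EuclideanSpace ℝ (Fin n)) := by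
      refine hc.preimage_mem_nhds ?_
      rw [hsymm0]; exact ball_mem_nhds p hρpos
    have h2 : (e p).target ∈ 𝓝 (0 : EuclideanSpace ℝ (Fin n)) := (e p).open_target.mem_nhds h0t
    obtain ⟨s, hs, hsub⟩ := Metric.mem_nhds_iff.1 (Filter.inter_mem h1 h2)
    refine ⟨s / 2, by positivity, fun y hy => (hsub ?_).2, fun y hy => (hsub ?_).1⟩
    · exact closedBall_subset_ball (by linarith) hy
    · exact closedBall_subset_ball (by linarith) hy
  choose! s hs hsT hsρ using hR
  obtain ⟨R, hRpos, hRle⟩ := exists_pos_forall_le_finset P hs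
  have hballT : ∀ p ∈ P, closedBall (0 : EuclideanSpace ℝ (Fin n)) R ⊆ (e p).target := fun p hp =>
    (closedBall_subset_closedBall (hRle p hp)).trans (hsT p hp)
  have himg : ∀ p ∈ P, (e p).symm '' closedBall (0 : EuclideanSpace ℝ (Fin n)) R ⊆ ball p ρ := by
    rintro p hp _ ⟨y, hy, rfl⟩
    exact hsρ p hp y (closedBall_subset_closedBall (hRle p hp) hy)
  refine ⟨R, e, hRpos, hemax, fun p hp => ⟨?_, ?_⟩, hballT, fun p hp y hy => ?_,
    fun p hp p' hp' hne => ?_, fun p hp => (himg p hp).trans (hρW p hp)⟩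
  · rw [hesource, neg_add_cancel]; exact hK0 p hp
  · rw [heapp, neg_add_cancel]; exact hK00 p hp
  · rw [hesymm]
    rw [hetarget] at hy
    exact hKquad p hp y hy
  · exact Set.disjoint_of_subset (himg p hp) (himg p' hp') (hρdisj p hp p' hp' hne)

/-- **Transport of Morse charts by a diffeomorphism.**  If `e_p` (`p ∈ P`) are charts of the
`C^∞` maximal atlas of `ℝⁿ` centred at the points of `P` with `B̄(0, R)` in their targets,
Milnor's normal form `f ∘ e_p⁻¹ = c - ξ + η` on the targets and pairwise disjoint closed chart
balls, and `Φ` is a diffeomorphism of `ℝⁿ`, then `e_p ∘ Φ⁻¹` are such charts for `f ∘ Φ⁻¹`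
at the points `Φ p`, with the same targets and radius, normal forms with the same indices, and
closed chart balls `Φ(e_p⁻¹ B̄(0, R))`. [folklore] -/
theorem exists_morseCharts_transport
    (Φ : (EuclideanSpace ℝ (Fin n)) ≃ₘ⟮𝓘(ℝ, EuclideanSpace ℝ (Fin n)), 𝓘(ℝ, EuclideanSpace ℝ (Fin n))⟯ (EuclideanSpace ℝ (Fin n))) {f : EuclideanSpace ℝ (Fin n) → ℝ} {c R : ℝ}
    (P : Finset (EuclideanSpace ℝ (Fin n))) (lam : EuclideanSpace ℝ (Fin n) → ℕ) (e : EuclideanSpace ℝ (Fin n) → OpenPartialHomeomorph (EuclideanSpace ℝ (Fin n)) (EuclideanSpace ℝ (Fin n)))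
    (he : ∀ p ∈ P, e p ∈ IsManifold.maximalAtlas (𝓡 n) ∞ (EuclideanSpace ℝ (Fin n)))
    (hpe : ∀ p ∈ P, p ∈ (e p).source ∧ e p p = 0)
    (hball : ∀ p ∈ P, closedBall (0 : EuclideanSpace ℝ (Fin n)) R ⊆ (e p).target)
    (hquad : ∀ p ∈ P, ∀ y ∈ (e p).target,
      f ((e p).symm y) = c - sqSumLT (lam p) y + sqSumGE (lam p) y)
    (hdisj : ∀ p ∈ P, ∀ p' ∈ P, p ≠ p' →
      Disjoint ((e p).symm '' closedBall (0 : EuclideanSpace ℝ (Fin n)) R) ((e p').symm '' closedBall (0 : EuclideanSpace ℝ (Fin n)) R)) :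
    ∃ e' : EuclideanSpace ℝ (Fin n) → OpenPartialHomeomorph (EuclideanSpace ℝ (Fin n)) (EuclideanSpace ℝ (Fin n)),
      (∀ q ∈ P.image Φ, e' q ∈ IsManifold.maximalAtlas (𝓡 n) ∞ (EuclideanSpace ℝ (Fin n))) ∧
      (∀ q ∈ P.image Φ, q ∈ (e' q).source ∧ e' q q = 0) ∧
      (∀ q ∈ P.image Φ, closedBall (0 : EuclideanSpace ℝ (Fin n)) R ⊆ (e' q).target) ∧
      (∀ q ∈ P.image Φ, ∀ y ∈ (e' q).target,
        (f ∘ Φ.symm) ((e' q).symm y) =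
          c - sqSumLT (lam (Φ.symm q)) y + sqSumGE (lam (Φ.symm q)) y) ∧
      (∀ q ∈ P.image Φ, ∀ q' ∈ P.image Φ, q ≠ q' →
        Disjoint ((e' q).symm '' closedBall (0 : EuclideanSpace ℝ (Fin n)) R)
          ((e' q').symm '' closedBall (0 : EuclideanSpace ℝ (Fin n)) R)) ∧
      (∀ q, (e' q).target = (e (Φ.symm q)).target) ∧
      (∀ q y, (e' q).symm y = Φ ((e (Φ.symm q)).symm y)) ∧
      (∀ q x, e' q x = e (Φ.symm q) (Φ.symm x)) ∧
      (∀ q x, x ∈ (e' q).source ↔ Φ.symm x ∈ (e (Φ.symm q)).source) := by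
  classical
  set T : OpenPartialHomeomorph (EuclideanSpace ℝ (Fin n)) (EuclideanSpace ℝ (Fin n)) := Φ.symm.toHomeomorph.toOpenPartialHomeomorph
    with hT
  have hTapp : ∀ x, T x = Φ.symm x := fun x => rfl
  have hTsymm : ∀ y, T.symm y = Φ y := fun y => rfl
  set e' : EuclideanSpace ℝ (Fin n) → OpenPartialHomeomorph (EuclideanSpace ℝ (Fin n)) (EuclideanSpace ℝ (Fin n)) := fun q => T.trans (e (Φ.symm q)) with he'
  have happ : ∀ q x, e' q x = e (Φ.symm q) (Φ.symm x) := fun q x => rfl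
  have hsymm : ∀ q y, (e' q).symm y = Φ ((e (Φ.symm q)).symm y) := fun q y => rfl
  have hsource : ∀ q x, x ∈ (e' q).source ↔ Φ.symm x ∈ (e (Φ.symm q)).source := fun q x => by
    simp [he', hT]
  have htarget : ∀ q, (e' q).target = (e (Φ.symm q)).target := fun q => by
    simp [he', hT]
  have hmem : ∀ q ∈ P.image Φ, Φ.symm q ∈ P := by
    intro q hq
    obtain ⟨p, hp, rfl⟩ := Finset.mem_image.1 hq
    rwa [Φ.symm_apply_apply]
  have hΦs : ContMDiff (𝓡 n) (𝓡 n) ∞ (Φ.symm : EuclideanSpace ℝ (Fin n) → EuclideanSpace ℝ (Fin n)) := Φ.symm.contMDiff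
  have hΦ : ContMDiff (𝓡 n) (𝓡 n) ∞ (Φ : EuclideanSpace ℝ (Fin n) → EuclideanSpace ℝ (Fin n)) := Φ.contMDiff
  refine ⟨e', fun q hq => ?_, fun q hq => ⟨?_, ?_⟩, fun q hq => ?_, fun q hq y hy => ?_,
    fun q hq q' hq' hne => ?_, htarget, hsymm, happ, hsource⟩
  · -- maximal atlas
    rw [IsManifold.mem_maximalAtlas_iff_contMDiffOn]
    constructor
    · have : (e' q : EuclideanSpace ℝ (Fin n) → EuclideanSpace ℝ (Fin n)) = e (Φ.symm q) ∘ Φ.symm := funext fun x => happ q x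
      rw [this]
      exact (contMDiffOn_of_mem_maximalAtlas (he _ (hmem q hq))).comp hΦs.contMDiffOn
        fun x hx => (hsource q x).1 hx
    · have : ((e' q).symm : EuclideanSpace ℝ (Fin n) → EuclideanSpace ℝ (Fin n)) = Φ ∘ (e (Φ.symm q)).symm := funext fun y => hsymm q y
      rw [this, htarget q]
      exact hΦ.comp_contMDiffOn (contMDiffOn_symm_of_mem_maximalAtlas (he _ (hmem q hq)))
  · rw [hsource]; exact (hpe _ (hmem q hq)).1
  · rw [happ]; exact (hpe _ (hmem q hq)).2
  · rw [htarget]; exact hball _ (hmem q hq)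
  · rw [htarget] at hy
    simp only [Function.comp_apply, hsymm, Φ.symm_apply_apply]
    exact hquad _ (hmem q hq) y hy
  · have hne' : Φ.symm q ≠ Φ.symm q' := fun h => hne (Φ.symm.injective h)
    have h1 : ∀ q₀, (e' q₀).symm '' closedBall (0 : EuclideanSpace ℝ (Fin n)) R =
        Φ '' ((e (Φ.symm q₀)).symm '' closedBall (0 : EuclideanSpace ℝ (Fin n)) R) := fun q₀ => by
      rw [image_image]
      exact image_congr fun y _ => hsymm q₀ y
    rw [h1 q, h1 q']
    exact (Set.disjoint_image_iff Φ.injective).2 (hdisj _ (hmem q hq) _ (hmem q' hq') hne')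

end Literature.Topology.FourManifolds

end
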